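/-
Copyright: statement-level skeleton of a published paper (lit-balaban cell, Phase-2 proof seat p25, gen 18). No proof
claims beyond what the kernel checks below.
-/
import Literature.MathematicalPhysics.QuantumFieldTheory.BalabanImbrieJaffe1984to88.BIJ88WalkRun311
import Literature.MathematicalPhysics.QuantumFieldTheory.BalabanImbrieJaffe1984to88.BIJ88LabelledRunEnv311

/-!
# `BalabanImbrieJaffe1984to88.BIJ88WalkRunEnv311` — T. Bałaban, J. Imbrie, A. Jaffe, *Effective action and cluster
properties of the abelian Higgs model*, Commun. Math. Phys. **114** (1988) 257–315 [BalabanImbrieJaffe1988], §5.14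
p. 311–312 [PDF 55–56] *"We stop integrating by parts fields in complete components of X. … We can arrange the
construction so that the {X_c} are determined once the remainder components are specified."* — **WHAT A RUN WITH THE
COVARIANCE SPLIT SEES: INDUCTION ALONG A RUN, INVARIANTS, AND THE TWO ENVIRONMENT LEMMAS** for `BIJ88WalkRun311.run`
(p25 gen 18; the covariance split `A⁻¹ = Σ_p Cov p` with the random-walk trigger).  The gen-16 file
`BIJ88LabelledRunEnv311` re-proved for the run with pieces: every event is offered through every piece, the records
(pieces, vertices, random-walk count) only grow, a constant outcome used no triggering piece, absorbed nothing and made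
no contraction to `χ′`; (I) the outcomes leaving a sub-environment untouched are the outcomes of the run in the
smaller environment; (II) constant outcomes do not see the complete components set aside.

statement-level skeleton of published theorems with citation tags; proofs where landed; nothing here is a claim
about the Yang–Mills mass gap

PDF held: `paper:balaban1988-cmp114-bij-abelian-higgs-effective-action` (journal page = PDF page + 256); p. 311–312 =
PDF 55–56 (`p0055.txt` L23–38, `p0056.txt` L1–9 re-read this session, 2026-08-22).

CITATION HEADER (lean-in-tree rule).  lit-balaban cell (HOME `run/shared/lean/pub/lit-balaban/`), Phase 2, seat p25
gen 18; row **C2.Claim@312** of `HOME/lit-balaban-r16/ROWS-C2-part2.md` (owner r16, referee ref-5; head untouched).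
USED BY NAME, nothing restated: `BIJ88WalkRun311.{WGrp, WOut, rpot, run, run_of_complete, run_of_not_complete,
rpot_*, WGrp.nv_lt_of_not_complete, WGrp.pend_ne_nil_of_not_complete}` (this seat and generation),
`BIJ88LabelledRun311.{fbind, mbind, mem_fbind, mem_mbind, filter_*, map_*, *_congr, fbind_eq_fbind_subset,
bind_eq_zero, mbind_eq_zero, mbind_zero}`, `BIJ88LabelledRunEnv311.erase_sdiff_erase_eq` (p25 gen 16),
`BIJ88VertexComponents311.maxArity` (p25 gen 15).

## What is proved (0 `sorry`, standard axioms, no new `Prop` facts, no new definitions)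

* §3 **`run_ind`** / `run_ind'` (induction along a run: the six events through every piece, mirrored),
  `run_rest_subset`, `run_done_le`, `run_complete`, **`run_mono`** (the `χ′`-count, the vertices, the labels, the
  pieces and the random-walk count only grow), `isRem_of_complete_of_lt`, **`run_const`** (a constant outcome:
  `o.D = []`, `o.done = done`, and no triggering piece was used in the run), `run_lab` (labels conserved),
  `run_dp_le_pcs` / `run_pcs_eq` (the pieces used in the run are recorded in the component; piece conservation).
* §4 **`run_filter_env`** (ENVIRONMENT LEMMA I), **`run_filter_const`** (ENVIRONMENT LEMMA II).
HONEST SCOPE: as in `BIJ88WalkRun311` (contraction-graph components, pieces and trigger are data, fixed order of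
events; no analysis).  NOT summit progress; NOT continuum; NOT Clay.  Imports `BIJ88WalkRun311`, `BIJ88LabelledRunEnv311`;
modifies nothing.
-/

noncomputable section

namespace Literature.MathematicalPhysics.QuantumFieldTheory.BalabanImbrieJaffe1984to88.BIJ88WalkRunEnv311

open Classical Matrix Finset
open scoped BigOperators
open BIJ88VertexComponents311 (maxArity length_legs_le)
open BIJ88LabelledRun311 (fbind mbind mem_fbind mem_mbind filter_bind filter_fbind filter_mbind map_fbind map_mbind
  fbind_congr mbind_congr fbind_eq_fbind_subset bind_eq_zero mbind_eq_zero mbind_zero)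
open BIJ88LabelledRunEnv311 (erase_sdiff_erase_eq)
open BIJ88WalkRun311

variable {S : Type} [Fintype S] {ι : Type} [Fintype ι] {κ : Type} [DecidableEq κ] {P : Type} [Fintype P]

/-! ## §3  Induction along a run; invariants -/

section Invariants

variable {Cov : P → Matrix S S ℝ} {trig : P → Bool} {f : S → ℝ} {c : ι → ℝ} {legs : ι → List (S → ℝ)}
  {obs : κ → List (S → ℝ)} {M : ℕ}

/-- **Induction along a run** (the six events of p. 311 through every covariance piece, mirrored): a property of
(state, outcome) that holds for the outcome "set aside" and is carried backwards through each of the six contractions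
through each piece holds for every outcome of every run. [cite: BalabanImbrieJaffe1988, §5.14 p.311] -/
theorem run_ind {Q : WGrp S κ ι P → Finset κ → Multiset (WGrp S κ ι P) → WOut S κ ι P → Prop}
    (hset : ∀ g rest done, g.complete M = true → Q g rest done ⟨1, [], 0, 0, g, rest, done⟩)
    (hpair : ∀ (g : WGrp S κ ι P) rest done u L (p : P), ¬ g.complete M = true → g.pend = u :: L → ∀ i,
      ∀ o ∈ run Cov trig f c legs obs M ⟨L.eraseIdx i, g.nchi, g.vxs, g.lab, p ::ₘ g.pcs, g.nw + (trig p).toNat⟩ rest done,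
        Q ⟨L.eraseIdx i, g.nchi, g.vxs, g.lab, p ::ₘ g.pcs, g.nw + (trig p).toNat⟩ rest done o →
          Q g rest done (o.scale p ((Cov p *ᵥ u) ⬝ᵥ L.getD i 0)))
    (hprist : ∀ (g : WGrp S κ ι P) rest done u L (p : P), ¬ g.complete M = true → g.pend = u :: L → ∀ j ∈ rest, ∀ i,
      ∀ o ∈ run Cov trig f c legs obs M
          ⟨L ++ (obs j).eraseIdx i, g.nchi, g.vxs, g.lab ∪ {j}, p ::ₘ g.pcs, g.nw + (trig p).toNat⟩ (rest.erase j) done,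
        Q ⟨L ++ (obs j).eraseIdx i, g.nchi, g.vxs, g.lab ∪ {j}, p ::ₘ g.pcs, g.nw + (trig p).toNat⟩ (rest.erase j) done o →
          Q g rest done (o.scale p ((Cov p *ᵥ u) ⬝ᵥ (obs j).getD i 0)))
    (habs : ∀ (g : WGrp S κ ι P) rest done u L (p : P), ¬ g.complete M = true → g.pend = u :: L → ∀ h ∈ done,
      ∀ i < h.pend.length, ∀ o ∈ run Cov trig f c legs obs M (WGrp.absorb trig L g h i p) rest (done.erase h),
        Q (WGrp.absorb trig L g h i p) rest (done.erase h) o → Q g rest done (o.scale p ((Cov p *ᵥ u) ⬝ᵥ h.pend.getD i 0)))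
    (hsrc : ∀ (g : WGrp S κ ι P) rest done u L (p : P), ¬ g.complete M = true → g.pend = u :: L →
      ∀ o ∈ run Cov trig f c legs obs M ⟨L, g.nchi, g.vxs, g.lab, p ::ₘ g.pcs, g.nw + (trig p).toNat⟩ rest done,
        Q ⟨L, g.nchi, g.vxs, g.lab, p ::ₘ g.pcs, g.nw + (trig p).toNat⟩ rest done o →
          Q g rest done (o.scale p ((Cov p *ᵥ u) ⬝ᵥ f)))
    (hchi : ∀ (g : WGrp S κ ι P) rest done u L (p : P), ¬ g.complete M = true → g.pend = u :: L →
      ∀ o ∈ run Cov trig f c legs obs M ⟨L, g.nchi + 1, g.vxs, g.lab, p ::ₘ g.pcs, g.nw + (trig p).toNat⟩ rest done,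
        Q ⟨L, g.nchi + 1, g.vxs, g.lab, p ::ₘ g.pcs, g.nw + (trig p).toNat⟩ rest done o →
          Q g rest done (o.push p (Cov p *ᵥ u)))
    (hvert : ∀ (g : WGrp S κ ι P) rest done u L (p : P), ¬ g.complete M = true → g.pend = u :: L → ∀ m j,
      ∀ o ∈ run Cov trig f c legs obs M
          ⟨L ++ (legs m).eraseIdx j, g.nchi, m ::ₘ g.vxs, g.lab, p ::ₘ g.pcs, g.nw + (trig p).toNat⟩ rest done,
        Q ⟨L ++ (legs m).eraseIdx j, g.nchi, m ::ₘ g.vxs, g.lab, p ::ₘ g.pcs, g.nw + (trig p).toNat⟩ rest done o →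
          Q g rest done ((o.scale p (-(c m * ((Cov p *ᵥ u) ⬝ᵥ (legs m).getD j 0)))).bump)) :
    ∀ (n : ℕ) (g : WGrp S κ ι P) (rest : Finset κ) (done : Multiset (WGrp S κ ι P)),
      rpot obs M (maxArity legs) g rest done < n → ∀ o ∈ run Cov trig f c legs obs M g rest done, Q g rest done o
  | 0, _, _, _, hn => absurd hn (Nat.not_lt_zero _)
  | n + 1, g, rest, done, hn => by
    intro o ho
    have hn' : rpot obs M (maxArity legs) g rest done ≤ n := Nat.lt_succ_iff.1 hn
    have IH : ∀ g' rest' done', rpot obs M (maxArity legs) g' rest' done' < rpot obs M (maxArity legs) g rest done →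
        ∀ o ∈ run Cov trig f c legs obs M g' rest' done', Q g' rest' done' o :=
      fun g' rest' done' hlt => run_ind hset hpair hprist habs hsrc hchi hvert n g' rest' done' (lt_of_lt_of_le hlt hn')
    rw [run] at ho
    split at ho
    · rename_i hc
      rw [Multiset.mem_singleton] at ho
      subst ho
      exact hset g rest done hc
    · rename_i hc
      split at ho
      · exact absurd ho (Multiset.notMem_zero _)
      · rename_i u L hp
        have hnv : Multiset.card g.vxs < M := WGrp.nv_lt_of_not_complete hc
        simp only [Multiset.mem_add, Multiset.mem_bind, Multiset.mem_map, Finset.mem_val, Finset.mem_range,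
          mem_fbind, mem_mbind, Finset.mem_univ, true_and] at ho
        obtain ⟨p, ho⟩ := ho
        rcases ho with (((((⟨i, -, o', ho', rfl⟩ | ⟨j, hj, i, -, o', ho', rfl⟩) | ⟨h, hh, i, hi, o', ho', rfl⟩) |
          ⟨o', ho', rfl⟩) | ⟨o', ho', rfl⟩) | ⟨m, j, -, o', ho', rfl⟩)
        · exact hpair g rest done u L p hc hp i o' ho' (IH _ _ _ (rpot_pair obs M _ rest done hp i _ _) o' ho')
        · exact hprist g rest done u L p hc hp j hj i o' ho'
            (IH _ _ _ (rpot_pristine obs M _ rest done hp hj i _ _ _) o' ho')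
        · exact habs g rest done u L p hc hp h hh i hi o' ho'
            (IH _ _ _ (rpot_absorb obs M _ rest done trig hp hh i p) o' ho')
        · exact hsrc g rest done u L p hc hp o' ho' (IH _ _ _ (rpot_drop obs M _ rest done hp _ _ _) o' ho')
        · exact hchi g rest done u L p hc hp o' ho' (IH _ _ _ (rpot_drop obs M _ rest done hp _ _ _) o' ho')
        · exact hvert g rest done u L p hc hp m j o' ho'
            (IH _ _ _ (rpot_vertex obs M rest done legs hp hnv m j _ _) o' ho')

/-- Shorthand: the conclusion of `run_ind` for every state. [cite: BalabanImbrieJaffe1988, §5.14 p.311] -/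
theorem run_ind' {Q : WGrp S κ ι P → Finset κ → Multiset (WGrp S κ ι P) → WOut S κ ι P → Prop}
    (hset : ∀ g rest done, g.complete M = true → Q g rest done ⟨1, [], 0, 0, g, rest, done⟩)
    (hpair : ∀ (g : WGrp S κ ι P) rest done u L (p : P), ¬ g.complete M = true → g.pend = u :: L → ∀ i,
      ∀ o ∈ run Cov trig f c legs obs M ⟨L.eraseIdx i, g.nchi, g.vxs, g.lab, p ::ₘ g.pcs, g.nw + (trig p).toNat⟩ rest done,
        Q ⟨L.eraseIdx i, g.nchi, g.vxs, g.lab, p ::ₘ g.pcs, g.nw + (trig p).toNat⟩ rest done o →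
          Q g rest done (o.scale p ((Cov p *ᵥ u) ⬝ᵥ L.getD i 0)))
    (hprist : ∀ (g : WGrp S κ ι P) rest done u L (p : P), ¬ g.complete M = true → g.pend = u :: L → ∀ j ∈ rest, ∀ i,
      ∀ o ∈ run Cov trig f c legs obs M
          ⟨L ++ (obs j).eraseIdx i, g.nchi, g.vxs, g.lab ∪ {j}, p ::ₘ g.pcs, g.nw + (trig p).toNat⟩ (rest.erase j) done,
        Q ⟨L ++ (obs j).eraseIdx i, g.nchi, g.vxs, g.lab ∪ {j}, p ::ₘ g.pcs, g.nw + (trig p).toNat⟩ (rest.erase j) done o →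
          Q g rest done (o.scale p ((Cov p *ᵥ u) ⬝ᵥ (obs j).getD i 0)))
    (habs : ∀ (g : WGrp S κ ι P) rest done u L (p : P), ¬ g.complete M = true → g.pend = u :: L → ∀ h ∈ done,
      ∀ i < h.pend.length, ∀ o ∈ run Cov trig f c legs obs M (WGrp.absorb trig L g h i p) rest (done.erase h),
        Q (WGrp.absorb trig L g h i p) rest (done.erase h) o → Q g rest done (o.scale p ((Cov p *ᵥ u) ⬝ᵥ h.pend.getD i 0)))
    (hsrc : ∀ (g : WGrp S κ ι P) rest done u L (p : P), ¬ g.complete M = true → g.pend = u :: L →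
      ∀ o ∈ run Cov trig f c legs obs M ⟨L, g.nchi, g.vxs, g.lab, p ::ₘ g.pcs, g.nw + (trig p).toNat⟩ rest done,
        Q ⟨L, g.nchi, g.vxs, g.lab, p ::ₘ g.pcs, g.nw + (trig p).toNat⟩ rest done o →
          Q g rest done (o.scale p ((Cov p *ᵥ u) ⬝ᵥ f)))
    (hchi : ∀ (g : WGrp S κ ι P) rest done u L (p : P), ¬ g.complete M = true → g.pend = u :: L →
      ∀ o ∈ run Cov trig f c legs obs M ⟨L, g.nchi + 1, g.vxs, g.lab, p ::ₘ g.pcs, g.nw + (trig p).toNat⟩ rest done,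
        Q ⟨L, g.nchi + 1, g.vxs, g.lab, p ::ₘ g.pcs, g.nw + (trig p).toNat⟩ rest done o →
          Q g rest done (o.push p (Cov p *ᵥ u)))
    (hvert : ∀ (g : WGrp S κ ι P) rest done u L (p : P), ¬ g.complete M = true → g.pend = u :: L → ∀ m j,
      ∀ o ∈ run Cov trig f c legs obs M
          ⟨L ++ (legs m).eraseIdx j, g.nchi, m ::ₘ g.vxs, g.lab, p ::ₘ g.pcs, g.nw + (trig p).toNat⟩ rest done,
        Q ⟨L ++ (legs m).eraseIdx j, g.nchi, m ::ₘ g.vxs, g.lab, p ::ₘ g.pcs, g.nw + (trig p).toNat⟩ rest done o →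
          Q g rest done ((o.scale p (-(c m * ((Cov p *ᵥ u) ⬝ᵥ (legs m).getD j 0)))).bump))
    (g : WGrp S κ ι P) (rest : Finset κ) (done : Multiset (WGrp S κ ι P)) :
    ∀ o ∈ run Cov trig f c legs obs M g rest done, Q g rest done o :=
  run_ind hset hpair hprist habs hsrc hchi hvert _ g rest done (Nat.lt_succ_self _)

/-- **The untouched observables of an outcome were in the environment.** [cite: BalabanImbrieJaffe1988, §5.14 p.311] -/
theorem run_rest_subset (g : WGrp S κ ι P) (rest : Finset κ) (done : Multiset (WGrp S κ ι P)) :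
    ∀ o ∈ run Cov trig f c legs obs M g rest done, o.rest ⊆ rest := by
  refine run_ind' (Q := fun _ rest _ o => o.rest ⊆ rest) (fun _ _ _ _ => subset_rfl) ?_ ?_ ?_ ?_ ?_ ?_ g rest done
  · intro g rest done u L p _ _ i o _ h; exact h
  · intro g rest done u L p _ _ j _ i o _ h; exact h.trans (Finset.erase_subset _ _)
  · intro g rest done u L p _ _ h _ i _ o _ h'; exact h'
  · intro g rest done u L p _ _ o _ h; exact h
  · intro g rest done u L p _ _ o _ h; exact h
  · intro g rest done u L p _ _ m j o _ h; exact h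

/-- **The untouched complete components of an outcome were set aside before.** [cite: BalabanImbrieJaffe1988, §5.14 p.311] -/
theorem run_done_le (g : WGrp S κ ι P) (rest : Finset κ) (done : Multiset (WGrp S κ ι P)) :
    ∀ o ∈ run Cov trig f c legs obs M g rest done, o.done ≤ done := by
  refine run_ind' (Q := fun _ _ done o => o.done ≤ done) (fun _ _ _ _ => le_rfl) ?_ ?_ ?_ ?_ ?_ ?_ g rest done
  · intro g rest done u L p _ _ i o _ h; exact h
  · intro g rest done u L p _ _ j _ i o _ h; exact h
  · intro g rest done u L p _ _ h _ i _ o _ h'; exact h'.trans (Multiset.erase_le _ _)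
  · intro g rest done u L p _ _ o _ h; exact h
  · intro g rest done u L p _ _ o _ h; exact h
  · intro g rest done u L p _ _ m j o _ h; exact h

/-- **Every outcome's component is complete** (*"We stop integrating by parts fields in complete components"*).
[cite: BalabanImbrieJaffe1988, §5.14 p.311] -/
theorem run_complete (g : WGrp S κ ι P) (rest : Finset κ) (done : Multiset (WGrp S κ ι P)) :
    ∀ o ∈ run Cov trig f c legs obs M g rest done, o.g.complete M = true := by
  refine run_ind' (Q := fun _ _ _ o => o.g.complete M = true) (fun _ _ _ h => h) ?_ ?_ ?_ ?_ ?_ ?_ g rest done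
  · intro g rest done u L p _ _ i o _ h; exact h
  · intro g rest done u L p _ _ j _ i o _ h; exact h
  · intro g rest done u L p _ _ h _ i _ o _ h'; exact h'
  · intro g rest done u L p _ _ o _ h; exact h
  · intro g rest done u L p _ _ o _ h; exact h
  · intro g rest done u L p _ _ m j o _ h; exact h

/-- **The records only grow along a run**: the `χ′`-count, the vertices, the labels, the pieces and the random-walk
count of the component. [cite: BalabanImbrieJaffe1988, §5.14 p.311] -/
theorem run_mono (g : WGrp S κ ι P) (rest : Finset κ) (done : Multiset (WGrp S κ ι P)) :
    ∀ o ∈ run Cov trig f c legs obs M g rest done,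
      g.nchi ≤ o.g.nchi ∧ g.vxs ≤ o.g.vxs ∧ g.lab ⊆ o.g.lab ∧ g.pcs ≤ o.g.pcs ∧ g.nw ≤ o.g.nw := by
  refine run_ind' (Q := fun g _ _ o => g.nchi ≤ o.g.nchi ∧ g.vxs ≤ o.g.vxs ∧ g.lab ⊆ o.g.lab ∧ g.pcs ≤ o.g.pcs
      ∧ g.nw ≤ o.g.nw) (fun _ _ _ _ => ⟨le_rfl, le_rfl, subset_rfl, le_rfl, le_rfl⟩) ?_ ?_ ?_ ?_ ?_ ?_ g rest done
  · intro g rest done u L p _ _ i o _ h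
    simp only [WOut.scale_g] at h ⊢
    exact ⟨h.1, h.2.1, h.2.2.1, (Multiset.le_cons_self _ _).trans h.2.2.2.1, le_of_add_le_left h.2.2.2.2⟩
  · intro g rest done u L p _ _ j _ i o _ h
    simp only [WOut.scale_g] at h ⊢
    exact ⟨h.1, h.2.1, Finset.subset_union_left.trans h.2.2.1, (Multiset.le_cons_self _ _).trans h.2.2.2.1,
      le_of_add_le_left h.2.2.2.2⟩
  · intro g rest done u L p _ _ h _ i _ o _ h'
    simp only [WGrp.absorb, WOut.scale_g] at h' ⊢
    exact ⟨le_of_add_le_left h'.1, (Multiset.le_add_right _ _).trans h'.2.1, Finset.subset_union_left.trans h'.2.2.1,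
      ((Multiset.le_add_right _ _).trans (Multiset.le_cons_self _ _)).trans h'.2.2.2.1,
      le_of_add_le_left (le_of_add_le_left h'.2.2.2.2)⟩
  · intro g rest done u L p _ _ o _ h
    simp only [WOut.scale_g] at h ⊢
    exact ⟨h.1, h.2.1, h.2.2.1, (Multiset.le_cons_self _ _).trans h.2.2.2.1, le_of_add_le_left h.2.2.2.2⟩
  · intro g rest done u L p _ _ o _ h
    simp only [WOut.push_g] at h ⊢
    exact ⟨Nat.le_of_succ_le h.1, h.2.1, h.2.2.1, (Multiset.le_cons_self _ _).trans h.2.2.2.1,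
      le_of_add_le_left h.2.2.2.2⟩
  · intro g rest done u L p _ _ m j o _ h
    simp only [WOut.bump_g, WOut.scale_g] at h ⊢
    exact ⟨h.1, (Multiset.le_cons_self _ _).trans h.2.1, h.2.2.1, (Multiset.le_cons_self _ _).trans h.2.2.2.1,
      le_of_add_le_left h.2.2.2.2⟩

omit [Fintype S] [Fintype ι] [DecidableEq κ] [Fintype P] in
/-- A complete component with a pending leg is a remainder component (its records say so).
[cite: BalabanImbrieJaffe1988, §5.14 p.311] -/
theorem isRem_of_complete_of_lt {h : WGrp S κ ι P} (hc : h.complete M = true) {i : ℕ} (hi : i < h.pend.length) :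
    h.IsRem M := by
  have hne : h.pend ≠ [] := by
    intro h0; rw [h0] at hi; exact Nat.not_lt_zero _ hi
  simp only [WGrp.complete, Bool.or_eq_true, List.isEmpty_iff, decide_eq_true_eq] at hc
  rcases hc with ((hc | hc) | hc) | hc
  · exact absurd hc hne
  · exact Or.inl hc
  · exact Or.inr (Or.inl hc)
  · exact Or.inr (Or.inr hc)

/-- **A CONSTANT OUTCOME MADE NO CONTRACTION TO `χ′`, ABSORBED NO COMPLETE COMPONENT AND USED NO RANDOM-WALK PIECE**:
if the complete components set aside are complete (as they are) and the outcome's component is constant, then the run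
produced no `χ′`-direction, left `done` untouched, and every piece used in the run is a local one.
[cite: BalabanImbrieJaffe1988, §5.14 p.311–312] -/
theorem run_const (g : WGrp S κ ι P) (rest : Finset κ) (done : Multiset (WGrp S κ ι P)) :
    ∀ o ∈ run Cov trig f c legs obs M g rest done, (∀ h ∈ done, h.complete M = true) → o.g.IsConst M →
      o.D = [] ∧ o.done = done ∧ ∀ p ∈ o.dp, trig p = false := by
  refine run_ind' (Q := fun _ _ done o => (∀ h ∈ done, h.complete M = true) → o.g.IsConst M →
      o.D = [] ∧ o.done = done ∧ ∀ p ∈ o.dp, trig p = false)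
    (fun _ _ _ _ _ _ => ⟨rfl, rfl, fun p hp => absurd hp (Multiset.notMem_zero _)⟩) ?_ ?_ ?_ ?_ ?_ ?_ g rest done
  · intro g rest done u L p _ _ i o ho IH hd hconst
    obtain ⟨h1, h2, h3⟩ := IH hd hconst
    have hm := (run_mono _ _ _ o ho).2.2.2.2
    refine ⟨h1, h2, fun q hq => ?_⟩
    simp only [WOut.scale_dp, Multiset.mem_cons] at hq
    rcases hq with rfl | hq
    · cases htr : trig q
      · rfl
      · simp only [WOut.scale_g, htr, Bool.toNat_true] at hm hconst; have := hconst.2.2.2; omega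
    · exact h3 q hq
  · intro g rest done u L p _ _ j _ i o ho IH hd hconst
    obtain ⟨h1, h2, h3⟩ := IH hd hconst
    have hm := (run_mono _ _ _ o ho).2.2.2.2
    refine ⟨h1, h2, fun q hq => ?_⟩
    simp only [WOut.scale_dp, Multiset.mem_cons] at hq
    rcases hq with rfl | hq
    · cases htr : trig q
      · rfl
      · simp only [WOut.scale_g, htr, Bool.toNat_true] at hm hconst; have := hconst.2.2.2; omega
    · exact h3 q hq
  · intro g rest done u L p _ _ h hh i hi o ho _ hd hconst
    -- absorbing a complete component with a pending leg makes the component a remainder one: no constant outcome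
    exfalso
    have hr := isRem_of_complete_of_lt (hd h hh) hi
    have hm := run_mono _ _ _ o ho
    have hcard := Multiset.card_le_card hm.2.1
    simp only [WGrp.absorb, WOut.scale_g, Multiset.card_add] at hm hconst hcard
    rcases hconst with ⟨-, h0, hlt, hw⟩
    rcases hr with hr | hr | hr <;> omega
  · intro g rest done u L p _ _ o ho IH hd hconst
    obtain ⟨h1, h2, h3⟩ := IH hd hconst
    have hm := (run_mono _ _ _ o ho).2.2.2.2
    refine ⟨h1, h2, fun q hq => ?_⟩
    simp only [WOut.scale_dp, Multiset.mem_cons] at hq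
    rcases hq with rfl | hq
    · cases htr : trig q
      · rfl
      · simp only [WOut.scale_g, htr, Bool.toNat_true] at hm hconst; have := hconst.2.2.2; omega
    · exact h3 q hq
  · intro g rest done u L p _ _ o ho _ hd hconst
    -- a contraction to χ′ makes the component a remainder one: no constant outcome
    exfalso
    have hm := run_mono _ _ _ o ho
    simp only [WOut.push_g] at hconst hm
    rcases hconst with ⟨-, h0, -, -⟩
    omega
  · intro g rest done u L p _ _ m j o ho IH hd hconst
    obtain ⟨h1, h2, h3⟩ := IH hd hconst
    have hm := (run_mono _ _ _ o ho).2.2.2.2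
    refine ⟨h1, h2, fun q hq => ?_⟩
    simp only [WOut.bump_dp, WOut.scale_dp, Multiset.mem_cons] at hq
    rcases hq with rfl | hq
    · cases htr : trig q
      · rfl
      · simp only [WOut.bump_g, WOut.scale_g, htr, Bool.toNat_true] at hm hconst; have := hconst.2.2.2; omega
    · exact h3 q hq

/-- **Label bookkeeping**: the labels of the component, of the complete components set aside and the untouched
observables are conserved along a run. [cite: BalabanImbrieJaffe1988, §5.14 p.311] -/
theorem run_lab (g : WGrp S κ ι P) (rest : Finset κ) (done : Multiset (WGrp S κ ι P)) :
    ∀ o ∈ run Cov trig f c legs obs M g rest done,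
      o.g.lab ∪ (o.done.map WGrp.lab).sup ∪ o.rest = g.lab ∪ (done.map WGrp.lab).sup ∪ rest := by
  refine run_ind' (Q := fun g rest done o =>
      o.g.lab ∪ (o.done.map WGrp.lab).sup ∪ o.rest = g.lab ∪ (done.map WGrp.lab).sup ∪ rest)
    (fun _ _ _ _ => rfl) ?_ ?_ ?_ ?_ ?_ ?_ g rest done
  · intro g rest done u L p _ _ i o _ h; exact h
  · intro g rest done u L p _ _ j hj i o _ h
    rw [WOut.scale_g, WOut.scale_done, WOut.scale_rest, h]
    conv_rhs => rw [← Finset.insert_erase hj]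
    ext x; simp only [Finset.mem_union, Finset.mem_singleton, Finset.mem_insert]; tauto
  · intro g rest done u L p _ _ h hh i _ o _ h'
    rw [WOut.scale_g, WOut.scale_done, WOut.scale_rest, h']
    conv_rhs => rw [← Multiset.cons_erase hh]
    simp only [WGrp.absorb, Multiset.map_cons, Multiset.sup_cons]
    ext x; simp only [Finset.mem_union, Finset.sup_eq_union]; tauto
  · intro g rest done u L p _ _ o _ h; exact h
  · intro g rest done u L p _ _ o _ h; exact h
  · intro g rest done u L p _ _ m j o _ h; exact h

/-- **Piece bookkeeping**: the pieces used in the run are recorded in the outcome's component (together with those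
of the component at the start). [cite: BalabanImbrieJaffe1988, §5.14 p.311] -/
theorem run_dp_le_pcs (g : WGrp S κ ι P) (rest : Finset κ) (done : Multiset (WGrp S κ ι P)) :
    ∀ o ∈ run Cov trig f c legs obs M g rest done, o.dp + g.pcs ≤ o.g.pcs := by
  refine run_ind' (Q := fun g _ _ o => o.dp + g.pcs ≤ o.g.pcs) (fun _ _ _ _ => by simp) ?_ ?_ ?_ ?_ ?_ ?_ g rest done
  · intro g rest done u L p _ _ i o _ h
    simp only [WOut.scale_dp, WOut.scale_g, Multiset.cons_add] at h ⊢; rwa [Multiset.add_cons] at h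
  · intro g rest done u L p _ _ j _ i o _ h
    simp only [WOut.scale_dp, WOut.scale_g, Multiset.cons_add] at h ⊢; rwa [Multiset.add_cons] at h
  · intro g rest done u L p _ _ h _ i _ o _ h'
    simp only [WGrp.absorb, WOut.scale_dp, WOut.scale_g, Multiset.cons_add] at h' ⊢
    rw [Multiset.add_cons, ← add_assoc] at h'
    exact le_trans (Multiset.cons_le_cons _ (Multiset.le_add_right _ _)) h'
  · intro g rest done u L p _ _ o _ h
    simp only [WOut.scale_dp, WOut.scale_g, Multiset.cons_add] at h ⊢; rwa [Multiset.add_cons] at h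
  · intro g rest done u L p _ _ o _ h
    simp only [WOut.push_dp, WOut.push_g, Multiset.cons_add] at h ⊢; rwa [Multiset.add_cons] at h
  · intro g rest done u L p _ _ m j o _ h
    simp only [WOut.bump_dp, WOut.bump_g, WOut.scale_dp, WOut.scale_g, Multiset.cons_add] at h ⊢
    rwa [Multiset.add_cons] at h

/-- **Piece conservation**: the pieces recorded in the outcome's component and in its set-aside components are the
pieces used in the run, those of the component at the start and those of the components set aside at the start (every
contraction is recorded exactly once). [cite: BalabanImbrieJaffe1988, §5.14 p.311] -/
theorem run_pcs_eq (g : WGrp S κ ι P) (rest : Finset κ) (done : Multiset (WGrp S κ ι P)) :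
    ∀ o ∈ run Cov trig f c legs obs M g rest done,
      o.g.pcs + (o.done.map WGrp.pcs).sum = o.dp + g.pcs + (done.map WGrp.pcs).sum := by
  refine run_ind' (Q := fun g _ done o => o.g.pcs + (o.done.map WGrp.pcs).sum = o.dp + g.pcs + (done.map WGrp.pcs).sum)
    (fun _ _ _ _ => by simp) ?_ ?_ ?_ ?_ ?_ ?_ g rest done
  · intro g rest done u L p _ _ i o _ h
    simp only [WOut.scale_g, WOut.scale_done, WOut.scale_dp] at h ⊢
    rw [h]
    simp only [Multiset.add_cons, Multiset.cons_add, add_assoc]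
  · intro g rest done u L p _ _ j _ i o _ h
    simp only [WOut.scale_g, WOut.scale_done, WOut.scale_dp] at h ⊢
    rw [h]
    simp only [Multiset.add_cons, Multiset.cons_add, add_assoc]
  · intro g rest done u L p _ _ h hh i _ o _ h'
    simp only [WGrp.absorb, WOut.scale_g, WOut.scale_done, WOut.scale_dp] at h' ⊢
    have e : (done.map WGrp.pcs).sum = h.pcs + ((done.erase h).map WGrp.pcs).sum := by
      conv_lhs => rw [← Multiset.cons_erase hh]
      rw [Multiset.map_cons, Multiset.sum_cons]
    rw [h', e]
    simp only [Multiset.add_cons, Multiset.cons_add, add_assoc]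
  · intro g rest done u L p _ _ o _ h
    simp only [WOut.scale_g, WOut.scale_done, WOut.scale_dp] at h ⊢
    rw [h]
    simp only [Multiset.add_cons, Multiset.cons_add, add_assoc]
  · intro g rest done u L p _ _ o _ h
    simp only [WOut.push_g, WOut.push_done, WOut.push_dp] at h ⊢
    rw [h]
    simp only [Multiset.add_cons, Multiset.cons_add, add_assoc]
  · intro g rest done u L p _ _ m j o _ h
    simp only [WOut.bump_g, WOut.bump_done, WOut.bump_dp, WOut.scale_g, WOut.scale_done, WOut.scale_dp] at h ⊢
    rw [h]
    simp only [Multiset.add_cons, Multiset.cons_add, add_assoc]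

end Invariants

/-! ## §4  The environment lemmas -/

section Env

variable {Cov : P → Matrix S S ℝ} {trig : P → Bool} {f : S → ℝ} {c : ι → ℝ} {legs : ι → List (S → ℝ)}
  {obs : κ → List (S → ℝ)} {M : ℕ}

/-- **ENVIRONMENT LEMMA I — a run sees only the observables it touches**: for a sub-environment `B ⊆ rest`, the
outcomes of the run in `rest` that leave `rest ∖ B` untouched are exactly the outcomes of the run in `B`, with `rest ∖ B`
put back into the environment (same weights, directions, vertices, pieces, component, complete components).
[cite: BalabanImbrieJaffe1988, §5.14 p.311–312] -/
theorem run_filter_env : ∀ (n : ℕ) (g : WGrp S κ ι P) (rest : Finset κ) (done : Multiset (WGrp S κ ι P)),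
    rpot obs M (maxArity legs) g rest done < n → ∀ (B : Finset κ), B ⊆ rest →
      (run Cov trig f c legs obs M g rest done).filter (fun o => rest \ B ⊆ o.rest)
        = (run Cov trig f c legs obs M g B done).map (fun o => { o with rest := o.rest ∪ (rest \ B) })
  | 0, _, _, _, hn => fun _ _ => absurd hn (Nat.not_lt_zero _)
  | n + 1, g, rest, done, hn => by
    intro B hB
    have hn' : rpot obs M (maxArity legs) g rest done ≤ n := Nat.lt_succ_iff.1 hn
    have IH : ∀ g' rest' done', rpot obs M (maxArity legs) g' rest' done' < rpot obs M (maxArity legs) g rest done →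
        ∀ (B' : Finset κ), B' ⊆ rest' →
          (run Cov trig f c legs obs M g' rest' done').filter (fun o => rest' \ B' ⊆ o.rest)
            = (run Cov trig f c legs obs M g' B' done').map (fun o => { o with rest := o.rest ∪ (rest' \ B') }) :=
      fun g' rest' done' hlt => run_filter_env n g' rest' done' (lt_of_lt_of_le hlt hn')
    by_cases hc : g.complete M = true
    · rw [run_of_complete Cov trig f c legs obs M hc, run_of_complete Cov trig f c legs obs M hc, Multiset.map_singleton,
        Multiset.filter_singleton, if_pos (Finset.sdiff_subset : rest \ B ⊆ rest)]
      simp only [Finset.union_sdiff_of_subset hB]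
    · obtain ⟨u, L, hp⟩ := List.exists_cons_of_ne_nil (WGrp.pend_ne_nil_of_not_complete hc)
      have hnv : Multiset.card g.vxs < M := WGrp.nv_lt_of_not_complete hc
      rw [run_of_not_complete Cov trig f c legs obs M hc hp rest done,
        run_of_not_complete Cov trig f c legs obs M hc hp B done]
      simp only [Multiset.filter_add, Multiset.map_add, filter_bind, Multiset.map_bind, filter_fbind, map_fbind,
        filter_mbind, map_mbind, Multiset.filter_map, Multiset.map_map, Function.comp_def, WOut.scale_rest,
        WOut.push_rest, WOut.bump_rest]
      refine Multiset.bind_congr fun p _ => ?_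
      refine congrArg₂ (· + ·) (congrArg₂ (· + ·) (congrArg₂ (· + ·) (congrArg₂ (· + ·) (congrArg₂ (· + ·)
        ?_ ?_) ?_) ?_) ?_) ?_
      · -- (1) inside the component
        refine Multiset.bind_congr fun i _ => ?_
        rw [IH _ _ _ (rpot_pair obs M _ rest done hp i _ _) _ hB, Multiset.map_map]
        rfl
      · -- (2) a pristine observable joins: it must lie in `B`
        rw [fbind_eq_fbind_subset hB _ (fun j => (range (obs j).length).val.bind fun i =>
            ((run Cov trig f c legs obs M
                ⟨L ++ (obs j).eraseIdx i, g.nchi, g.vxs, g.lab ∪ {j}, p ::ₘ g.pcs, g.nw + (trig p).toNat⟩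
                (rest.erase j) done).filter fun o => rest \ B ⊆ o.rest).map
              (WOut.scale p ((Cov p *ᵥ u) ⬝ᵥ (obs j).getD i 0))) (fun j _ => rfl) ?_]
        · refine fbind_congr fun j hj => Multiset.bind_congr fun i _ => ?_
          have h := IH _ _ _ (rpot_pristine obs M _ rest done hp (hB hj) i (g.lab ∪ {j}) (p ::ₘ g.pcs)
            (g.nw + (trig p).toNat)) _ (Finset.erase_subset_erase j hB)
          rw [erase_sdiff_erase_eq hj] at h
          rw [h, Multiset.map_map]
          rfl
        · intro j hj hjB
          refine bind_eq_zero fun i _ => ?_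
          rw [Multiset.filter_eq_nil.2, Multiset.map_zero]
          intro o ho hsub
          have h1 := run_rest_subset _ _ _ o ho (hsub (Finset.mem_sdiff.2 ⟨hj, hjB⟩))
          exact (Finset.notMem_erase j rest) h1
      · -- (3) a complete component joins
        refine mbind_congr fun h hh => Multiset.bind_congr fun i _ => ?_
        rw [IH _ _ _ (rpot_absorb obs M _ rest done trig hp hh i p) _ hB, Multiset.map_map]
        rfl
      · -- (4) the source
        rw [IH _ _ _ (rpot_drop obs M _ rest done hp _ _ _) _ hB, Multiset.map_map]
        rfl
      · -- (5) χ′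
        rw [IH _ _ _ (rpot_drop obs M _ rest done hp _ _ _) _ hB, Multiset.map_map]
        rfl
      · -- (6) a vertex
        refine Multiset.bind_congr fun m _ => Multiset.bind_congr fun j _ => ?_
        rw [IH _ _ _ (rpot_vertex obs M rest done legs hp hnv m j _ _) _ hB, Multiset.map_map]
        rfl

/-- **ENVIRONMENT LEMMA II — constant outcomes do not see the complete components set aside**: if the components in
`done` are complete, the constant outcomes of the run with `done` are the constant outcomes of the run with no
component set aside, `done` put back (a constant component is built from pristine observables only: absorbing a
complete component with a pending leg, or contracting to `χ′`, makes the component a remainder one).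
[cite: BalabanImbrieJaffe1988, §5.14 p.311–312] -/
theorem run_filter_const : ∀ (n : ℕ) (g : WGrp S κ ι P) (rest : Finset κ) (done : Multiset (WGrp S κ ι P)),
    rpot obs M (maxArity legs) g rest done < n → (∀ h ∈ done, h.complete M = true) →
      (run Cov trig f c legs obs M g rest done).filter (fun o => o.g.IsConst M)
        = ((run Cov trig f c legs obs M g rest 0).filter (fun o => o.g.IsConst M)).map (fun o => { o with done := done })
  | 0, _, _, _, hn => absurd hn (Nat.not_lt_zero _)
  | n + 1, g, rest, done, hn => by
    intro hd
    have hn' : rpot obs M (maxArity legs) g rest done ≤ n := Nat.lt_succ_iff.1 hn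
    have IH : ∀ g' rest' done', rpot obs M (maxArity legs) g' rest' done' < rpot obs M (maxArity legs) g rest done →
        (∀ h ∈ done', h.complete M = true) →
          (run Cov trig f c legs obs M g' rest' done').filter (fun o => o.g.IsConst M)
            = ((run Cov trig f c legs obs M g' rest' 0).filter (fun o => o.g.IsConst M)).map
                (fun o => { o with done := done' }) :=
      fun g' rest' done' hlt => run_filter_const n g' rest' done' (lt_of_lt_of_le hlt hn')
    by_cases hc : g.complete M = true
    · rw [run_of_complete Cov trig f c legs obs M hc, run_of_complete Cov trig f c legs obs M hc,
        Multiset.filter_singleton, Multiset.filter_singleton]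
      by_cases hg : g.IsConst M
      · rw [if_pos hg, if_pos hg, Multiset.map_singleton]
      · rw [if_neg hg, if_neg hg]
        rfl
    · obtain ⟨u, L, hp⟩ := List.exists_cons_of_ne_nil (WGrp.pend_ne_nil_of_not_complete hc)
      have hnv : Multiset.card g.vxs < M := WGrp.nv_lt_of_not_complete hc
      rw [run_of_not_complete Cov trig f c legs obs M hc hp rest done,
        run_of_not_complete Cov trig f c legs obs M hc hp rest 0]
      simp only [Multiset.filter_add, Multiset.map_add, filter_bind, Multiset.map_bind, filter_fbind, map_fbind,
        filter_mbind, Multiset.filter_map, Multiset.map_map, Function.comp_def, WOut.scale_g,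
        WOut.push_g, WOut.bump_g, mbind_zero]
      refine Multiset.bind_congr fun p _ => ?_
      refine congrArg₂ (· + ·) (congrArg₂ (· + ·) (congrArg₂ (· + ·) (congrArg₂ (· + ·) (congrArg₂ (· + ·)
        ?_ ?_) ?_) ?_) ?_) ?_
      · refine Multiset.bind_congr fun i _ => ?_
        rw [IH _ _ _ (rpot_pair obs M _ rest done hp i _ _) hd, Multiset.map_map]
        rfl
      · refine fbind_congr fun j hj => Multiset.bind_congr fun i _ => ?_
        rw [IH _ _ _ (rpot_pristine obs M _ rest done hp hj i (g.lab ∪ {j}) _ _) hd, Multiset.map_map]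
        rfl
      · -- (3) absorbing a complete component never yields a constant outcome
        refine mbind_eq_zero fun h hh => bind_eq_zero fun i hi => ?_
        rw [Multiset.filter_eq_nil.2, Multiset.map_zero]
        intro o ho hconst
        have hi' : i < h.pend.length := by simpa using hi
        have hr := isRem_of_complete_of_lt (hd h hh) hi'
        have hm := run_mono _ _ _ o ho
        have hcard := Multiset.card_le_card hm.2.1
        simp only [WGrp.absorb, Multiset.card_add] at hm hcard
        rcases hconst with ⟨-, h0, hlt, hw⟩
        rcases hr with hr | hr | hr <;> omega
      · rw [IH _ _ _ (rpot_drop obs M _ rest done hp _ _ _) hd, Multiset.map_map]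
        rfl
      · rw [IH _ _ _ (rpot_drop obs M _ rest done hp _ _ _) hd, Multiset.map_map]
        rfl
      · refine Multiset.bind_congr fun m _ => Multiset.bind_congr fun j _ => ?_
        rw [IH _ _ _ (rpot_vertex obs M rest done legs hp hnv m j _ _) hd, Multiset.map_map]
        rfl

end Env

end Literature.MathematicalPhysics.QuantumFieldTheory.BalabanImbrieJaffe1984to88.BIJ88WalkRunEnv311

end
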